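import Mathlib.Topology.Instances.ZMod
import Mathlib.Topology.Algebra.Group.Basic
import Mathlib.Data.ZMod.Basic
import Literature.AnabelianGeometry.AbsoluteAnabelian.AbsTopII.EllipticAdmissible
import HarnessLib

/-!
# [AbsTopII] Cor 3.3 (ii) over the isogeny-level model: the universal closure of the schema
# `Cor_3_3_ii` is FALSE (kernel counter-model) — FACT-LIST row F-0234

S. Mochizuki, *Topics in Absolute Anabelian Geometry II: Decomposition Groups and Endomorphisms*
[AbsTopII], Corollary 3.3 (ii) p. 68 (manuscript pagination, lit key `paper:url-585b8d0ad0d9`;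
bib key `MochizukiAbsTopII2013`).  PROOF-ONLY companion of `AbsTopII/EllipticAdmissible.lean`
(abc-iut-L4-t6, p404980), which types Cor 3.3 (ii) — "the collection of open subgroups
`Π_D ⊆ Π_C` that arise from finite étale double coverings `D → C` that exhibit `C` as semi-elliptic
[...] may be characterized group-theoretically as the collection of open subgroups `J ⊆ Π_C` of
index `2` such that `J ∩ Δ_C` is torsion-free" — as the SCHEMA
`Cor_3_3_ii (M : IsogenyModel) : Prop` over the isogeny-level MODEL INTERFACE `IsogenyModel`
(shape (M); "no instance in the tree; a junk model falsifies only statements about itself").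

abc-iut cell, FACT-LIST row **F-0234** (`kernel_closedness = parametrised`).  Plan rule R1/R5
(abc-iut-plan 05:41:23Z): for a parametrised row, (i) prove the universal closure if it is true,
(ii) otherwise file the kernel refutation `not_forall_<decl>` and prove the instance forms the cone
consumes.  This file does (ii): `exists_not_cor_3_3_ii` / `not_forall_cor_3_3_ii` exhibit (inside
the proof; nothing is added to the library) a finite DEGENERATE isogeny-level model — two "curves",
`Π_D = ℤ/2`, `Π_C = ℤ/2 × ℤ/2`, trivial Galois groups (so `Δ_C = Π_C`), one finite étale morphism
`D → C` inducing the first-factor inclusion — in which `C` is semi-elliptic as typed while the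
subgroup `Π_D ⊆ Π_C` (index `2`) has the `2`-torsion element `(1, 0)` in `Π_D ∩ Δ_C`, so it is NOT
in `semiEllipticDoubleCoverSubgroups (π₁(C) ↠ G)`; hence `Cor_3_3_ii M` fails at this `M`, and the
universal closure `∀ M, Cor_3_3_ii M` is false.  CONSUMER CENSUS (R5): the only consumer of the
named fact, `Cor_3_3_ii.image_doubleCovers_eq` (`AbsTopII/SemiEllipticTransport.lean`), takes
`(h : Cor_3_3_ii M)` for a GENERIC `M`; no named `IsogenyModel` instance exists in the tree, so
there is no instance form to prove — the row is a schema to be consumed BY NAME at the (future)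
étale-`π₁` model, exactly as its docstring says.

HONEST FRAMING: a toy counter-model of the abstract schema; it says nothing about hyperbolic
orbicurves, nothing about [AbsTopII] Cor 3.3 (ii) itself (a refereed, published theorem), and
nothing about [IUTchIII] Cor 3.12; no side taken; typed ≠ proved for the geometric instance.
-/

namespace Literature.AnabelianGeometry.AbsoluteAnabelian.AbsTopII

open FundamentalExtension

/-- **The schema `Cor_3_3_ii` fails at some isogeny-level model** (FACT-LIST F-0234, kernel
counter-model): there is an `IsogenyModel` — `Curve = Bool`, `Π_true = ℤ/2`, `Π_false = ℤ/2 × ℤ/2`,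
trivial Galois groups, a single finite étale morphism `true → false` inducing `a ↦ (a, 0)` — whose
curve `false` is semi-elliptic as typed (`IsSemiElliptic`) but for which the subgroup
`Π_true ⊆ Π_false` arising from the double covering is not in `semiEllipticDoubleCoverSubgroups`
(its intersection with `Δ = Π_false` contains `2`-torsion).
[cite: MochizukiAbsTopII2013, Cor 3.3 (ii) p.68] -/
theorem exists_not_cor_3_3_ii : ∃ M : IsogenyModel.{0}, ¬ Cor_3_3_ii M := by
  classical
  -- the groups: `A = ℤ/2` (multiplicatively, discrete) and the trivial Galois group
  let A : Type := Multiplicative (ZMod 2)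
  let G₁ : Type := PUnit.{1}
  -- the two extensions `Π_D = A ↠ 1`, `Π_C = A × A ↠ 1`
  let E₁ : FundamentalExtension.{0} :=
    ⟨ProfiniteGrp.of A, ProfiniteGrp.of G₁, 1, fun _ => ⟨1, Subsingleton.elim _ _⟩⟩
  let E₂ : FundamentalExtension.{0} :=
    ⟨ProfiniteGrp.of (A × A), ProfiniteGrp.of G₁, 1, fun _ => ⟨1, Subsingleton.elim _ _⟩⟩
  -- the morphism of extensions induced by `D → C`: first-factor inclusion on `Π`, identity on `G`
  let φ : E₁ ⟶ E₂ :=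
    ⟨ContinuousMonoidHom.inl A A, ContinuousMonoidHom.id _, fun _ => Subsingleton.elim _ _⟩
  have hinl : ∀ a : A, φ.arith a = (a, (1 : A)) := fun _ => rfl
  have hinj : Function.Injective φ.arith := fun a b h => by
    have h' := congrArg Prod.fst h
    rwa [hinl, hinl] at h'
  have hdisc₂ : DiscreteTopology E₂.arith := inferInstanceAs (DiscreteTopology (A × A))
  have hφ : φ.IsOpenInjective :=
    { arith_injective := hinj
      isOpen_range_arith := isOpen_discrete _
      gal_injective := fun _ _ _ => Subsingleton.elim _ _
      isOpen_range_gal := by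
        rw [show Set.range φ.gal = Set.univ from Set.range_eq_univ.mpr fun x => ⟨x, rfl⟩]
        exact isOpen_univ }
  -- the model
  let M : IsogenyModel.{0} :=
    { Curve := Bool
      ext := fun b => cond b E₁ E₂
      FinEt := fun Y X => PLift (Y = true ∧ X = false)
      extMap := fun {Y X} f =>
        match Y, X, f with
        | true, false, _ => φ
        | false, _, ⟨h⟩ => absurd h.1 Bool.false_ne_true
        | true, true, ⟨h⟩ => absurd h.2.symm Bool.false_ne_true
      extMap_isOpenInjective := fun {Y X} f =>
        match Y, X, f with
        | true, false, _ => hφ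
        | false, _, ⟨h⟩ => absurd h.1 Bool.false_ne_true
        | true, true, ⟨h⟩ => absurd h.2.symm Bool.false_ne_true
      IsScheme := fun b => b = true
      genus := fun _ => 1
      cuspCard := fun _ => 1
      IsDefinedOverNF := fun _ => True }
  -- the double covering `D → C` of the model
  let f : M.FinEt true false := ⟨⟨rfl, rfl⟩⟩
  have hext : M.extMap f = φ := rfl
  -- its subgroup `Π_D ⊆ Π_C` is the range of the first-factor inclusion
  have hJ : M.arithImage f = φ.arith.toMonoidHom.range := rfl
  -- `[Π_C : Π_D] = 2`
  have hcardA : Nat.card A = 2 := by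
    simp [A, Nat.card_eq_fintype_card]
  have hcardAA : Nat.card (A × A) = 4 := by
    rw [Nat.card_prod, hcardA]
  have hcardJ : Nat.card (φ.arith.toMonoidHom.range) = 2 :=
    (Nat.card_congr (MonoidHom.ofInjective hinj).toEquiv).symm.trans hcardA
  have hindex : (φ.arith.toMonoidHom.range).index = 2 := by
    have h := (φ.arith.toMonoidHom.range).card_mul_index
    rw [hcardJ] at h
    have h4 : Nat.card E₂.arith = 4 := hcardAA
    rw [h4] at h
    omega
  have hdeg : M.degree f = 2 := by
    show (M.arithImage f).index = 2
    rw [hJ]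
    exact hindex
  -- `C = false` is semi-elliptic as typed
  have hsemi : M.IsSemiElliptic false := by
    refine ⟨Bool.false_ne_true, true, f, ?_, ⟨rfl, rfl, rfl⟩, hdeg⟩
    show Function.Bijective (M.extMap f).gal
    rw [hext]
    exact ⟨hφ.gal_injective, fun x => ⟨x, rfl⟩⟩
  -- but `Π_D ∩ Δ_C = Π_D` has `2`-torsion: the element `(g, 1)`, `g` the generator of `ℤ/2`
  let g : A := Multiplicative.ofAdd (1 : ZMod 2)
  have hg1 : g ≠ 1 := by decide
  have hg2 : g ^ 2 = 1 := by decide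
  have hgeom : ∀ x : E₂.arith, x ∈ E₂.geom := fun x => Subsingleton.elim _ _
  have hnot : M.arithImage f ∉ semiEllipticDoubleCoverSubgroups (M.ext false) := by
    rintro ⟨-, -, htf⟩
    have hmem : ((g, (1 : A)) : E₂.arith) ∈ M.arithImage f ⊓ (M.ext false).geom :=
      ⟨⟨g, hinl g⟩, hgeom _⟩
    let y : ↥(M.arithImage f ⊓ (M.ext false).geom) := ⟨(g, 1), hmem⟩
    have hx2 : ((g, (1 : A)) : A × A) ^ 2 = 1 ^ 2 := by
      rw [Prod.pow_mk, hg2, one_pow, one_pow]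
      rfl
    have hy2 : y ^ 2 = 1 ^ 2 := Subtype.ext hx2
    have hy : y = 1 := htf.pow_left_injective two_ne_zero hy2
    exact hg1 (congrArg (fun z => z.1.1) hy)
  -- whereas `Cor_3_3_ii M` would put it in that set
  refine ⟨M, fun hM => hnot ?_⟩
  rw [← hM false hsemi]
  exact ⟨true, f, by
    show Function.Bijective (M.extMap f).gal
    rw [hext]
    exact ⟨hφ.gal_injective, fun x => ⟨x, rfl⟩⟩, ⟨rfl, rfl, rfl⟩, hdeg, rfl⟩

/-- **FACT-LIST F-0234: the universal closure of the schema `Cor_3_3_ii` is false** — the row is a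
SCHEMA over the isogeny-level model interface, to be consumed BY NAME at the intended (étale-`π₁`)
model, not a closed fact: `¬ ∀ M, Cor_3_3_ii M` (kernel counter-model `exists_not_cor_3_3_ii`).
Says nothing about the published theorem [AbsTopII] Cor 3.3 (ii) at the geometric instance.
[cite: MochizukiAbsTopII2013, Cor 3.3 (ii) p.68] -/
theorem not_forall_cor_3_3_ii : ¬ ∀ M : IsogenyModel.{0}, Cor_3_3_ii M := by
  obtain ⟨M, hM⟩ := exists_not_cor_3_3_ii
  exact fun h => hM (h M)

end Literature.AnabelianGeometry.AbsoluteAnabelian.AbsTopII
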